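import Summits.RiemannHypothesis.RiemannHypothesis.Theorems.HandoffFlatProfile
import HarnessLib

/-!
# HANDOFF, edge block: the polar mass and the `log(1/r)` energy ceiling of a FLAT lobe (rh-explicit, track «HANDOFF», seat prove-2 gen3, ATTEMPT-9 §2)

HONEST FRAMING. Nothing here bears on RH. Continuation of `HandoffFlatProfile.lean`; theorems only.

* `normSq_weilMellin_flatLobe_one_ge` — `|f̂(1)|² ≥ e^{x₀ − r}·r²·M_k²` for `f = flatLobe k r x₀` (PROVED): the polar mass the
  odd sector cannot compensate, now with the full mass `M_k ≥ 2 − 2/(k+2)` and the exact factor `e^{−r}` instead of `e^{−1}`.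
* `re_weilQuadratic_flatLobe_le` — **`Re Q(f) ≤ (log(1/r) + flatEnergyConst k)·∫‖f‖²`** for `0 < r ≤ 1/4` (PROVED),
  `flatEnergyConst k = 6.125 + L_k/(2π)` with the unevaluated but finite log-moment `L_k`; the leading coefficient `1` of
  `log(1/r)` is exact (Plancherel), only the additive constant depends on `k` (pattern of `re_weilQuadratic_cramerBump_le`).
-/

set_option linter.dupNamespace false

noncomputable section

open Complex Filter Set MeasureTheory Metric Literature.NumberTheory.LFunctions
  Literature.NumberTheory.LFunctions.WeilContinuous
open scoped Real Topology ComplexConjugate ContDiff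

namespace Summit.RiemannHypothesis.RiemannHypothesis.Theorems.Handoff

variable {k : ℕ} {r : ℝ}

/-- **The polar mass of the flat lobe**: `|f̂(1)|² ≥ e^{x₀ − r}·r²·M_k²` (`r > 0`): `f̂(1) = e^{x₀/2}·r·ψ̂_k(½ + r/2)` and
`Re ψ̂_k(½ + r/2) ≥ e^{−r/2}·M_k`. [this track, ATTEMPT-9 §2] -/
theorem normSq_weilMellin_flatLobe_one_ge (hr : 0 < r) (x₀ : ℝ) :
    Real.exp (x₀ - r) * r ^ 2 * flatMass k ^ 2 ≤ Complex.normSq (weilMellin (flatLobe k r x₀) 1) := by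
  rw [weilMellin_flatLobe hr]
  have e1 : ((1 : ℂ) - 1 / 2) * (x₀ : ℂ) = ((x₀ / 2 : ℝ) : ℂ) := by push_cast; ring
  have e2 : (1 : ℂ) / 2 + (r : ℂ) * (1 - 1 / 2) = (((1 / 2 + r / 2 : ℝ)) : ℂ) := by push_cast; ring
  rw [e1, e2]
  set M := weilMellin (flatProfile k) ((1 / 2 + r / 2 : ℝ) : ℂ) with hM
  have hre : Real.exp (-(r / 2)) * flatMass k ≤ M.re := by
    have h := re_weilMellin_flatProfile_real_ge k (1 / 2 + r / 2)
    rwa [show (1:ℝ)/2 + r/2 - 1/2 = r/2 by ring, abs_of_pos (by positivity)] at h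
  have hMk : 0 ≤ flatMass k := by linarith [one_le_flatMass k]
  have hlow : 0 ≤ Real.exp (-(r / 2)) * flatMass k := by positivity
  have hprod_re : (cexp ((x₀ / 2 : ℝ) : ℂ) * ((r : ℂ) * M)).re = Real.exp (x₀ / 2) * r * M.re := by
    rw [Complex.mul_re, Complex.exp_ofReal_re, Complex.exp_ofReal_im, Complex.mul_re, Complex.mul_im,
      Complex.ofReal_re, Complex.ofReal_im]
    ring
  have hge : (Real.exp (x₀ / 2) * r * M.re) ^ 2 ≤ Complex.normSq (cexp ((x₀ / 2 : ℝ) : ℂ) * ((r : ℂ) * M)) := by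
    rw [← hprod_re, Complex.normSq_apply]
    nlinarith [sq_nonneg ((cexp ((x₀ / 2 : ℝ) : ℂ) * ((r : ℂ) * M)).im)]
  have h1 : Real.exp (x₀ / 2) * r * (Real.exp (-(r / 2)) * flatMass k) ≤ Real.exp (x₀ / 2) * r * M.re :=
    mul_le_mul_of_nonneg_left hre (by positivity)
  have h2 : (Real.exp (x₀ / 2) * r * (Real.exp (-(r / 2)) * flatMass k)) ^ 2 = Real.exp (x₀ - r) * r ^ 2 * flatMass k ^ 2 := by
    have : Real.exp (x₀ - r) = (Real.exp (x₀ / 2) * Real.exp (-(r / 2))) ^ 2 := by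
      rw [← Real.exp_add, sq, ← Real.exp_add]; ring_nf
    rw [this]; ring
  calc Real.exp (x₀ - r) * r ^ 2 * flatMass k ^ 2
      = (Real.exp (x₀ / 2) * r * (Real.exp (-(r / 2)) * flatMass k)) ^ 2 := h2.symm
    _ ≤ (Real.exp (x₀ / 2) * r * M.re) ^ 2 := pow_le_pow_left₀ (by positivity) h1 2
    _ ≤ _ := hge

/-! ## §4 The energy ceiling of a flat lobe -/

/-- **Energy ceiling of a flat lobe.** For `0 < r ≤ 1/4` and any centre `x₀`:
`Re Q(flatLobe k r x₀) ≤ (log(1/r) + flatEnergyConst k)·∫‖flatLobe k r x₀‖²`. Translation invariance puts the lobe at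
`0`, where `Re Q = E` (support below `(log 2)/2`); `Re ψ(¼+it/2) ≤ log(1+|t|) + 3`, `log(1+|t|) ≤ log(1/r) + log(1+|rt|)`,
Plancherel `∫‖f̂‖² = 2π‖f‖₂²` (the EXACT coefficient `1` of `log(1/r)`), the substitution `u = rt` producing `r·L_k`, the
polar term `≤ 2(2r e^{1/8})² ≤ 3.125·r ≤ 3.125·‖f‖₂²` and `r·L_k/(2π) ≤ (L_k/(2π))·‖f‖₂²` (`‖f‖₂² = rN_k ≥ r`).
[this track, ATTEMPT-9 §2; cite: Bombieri2000, §12 (12.3)–(12.5) for E(g)] -/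
theorem re_weilQuadratic_flatLobe_le (hr : 0 < r) (hr4 : r ≤ 1 / 4) (x₀ : ℝ) :
    (weilQuadratic (flatLobe k r x₀)).re ≤
      (Real.log (1 / r) + flatEnergyConst k) * ∫ x : ℝ, ‖flatLobe k r x₀ x‖ ^ 2 := by
  set f₀ : ℝ → ℂ := flatLobe k r 0 with hf₀
  have hf₀t : IsWeilTest f₀ := isWeilTest_flatLobe hr 0
  have htrans : weilQuadratic (flatLobe k r x₀) = weilQuadratic f₀ := by
    have e : flatLobe k r x₀ = fun x ↦ f₀ (x - x₀) := by
      funext x; simp [hf₀, flatLobe]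
    rw [e, weilQuadratic_translate]
  have hN : ∫ x : ℝ, ‖flatLobe k r x₀ x‖ ^ 2 = r * weilNorm2Sq (flatProfile k) := integral_norm_sq_flatLobe hr x₀
  have hN0 : ∫ x : ℝ, ‖f₀ x‖ ^ 2 = r * weilNorm2Sq (flatProfile k) := integral_norm_sq_flatLobe hr 0
  set N := r * weilNorm2Sq (flatProfile k) with hNdef
  have hφ := one_le_weilNorm2Sq_flatProfile k
  have hNr : r ≤ N := by rw [hNdef]; nlinarith
  have hNpos : 0 < N := by linarith
  rw [htrans, hN]
  have hsupp0 : tsupport f₀ ⊆ Icc (-r) r := by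
    have := tsupport_flatLobe_subset (k := k) hr 0
    simpa using this
  have hl2 := Real.log_two_gt_d9
  have hsupp2 : tsupport f₀ ⊆ Icc (-(Real.log 2 / 2)) (Real.log 2 / 2) :=
    hsupp0.trans (Icc_subset_Icc (by linarith) (by linarith))
  rw [weilQuadratic_re_eq_weilArchQuadratic hf₀t hsupp2, weilArchQuadratic_eq]
  -- the values at 0 and 1
  have he18 : Real.exp (1 / 8 : ℝ) ≤ 1.25 := by
    have h := Real.abs_exp_sub_one_le (x := (1 / 8 : ℝ)) (by norm_num)
    have := (abs_le.1 h).2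
    norm_num at this ⊢
    linarith
  have hM0 : ‖weilMellin f₀ 0‖ ≤ 2.5 * r := by
    have h := norm_weilMellin_flatLobe_zero_le (k := k) hr 0
    have ha : r * |(0 : ℂ).re - 1 / 2| ≤ 1 / 8 := by
      simp only [Complex.zero_re, zero_sub, abs_neg]; rw [abs_of_pos (by norm_num)]; linarith
    have he : Real.exp (r * |(0 : ℂ).re - 1 / 2|) ≤ 1.25 := (Real.exp_le_exp.2 ha).trans he18
    calc ‖weilMellin f₀ 0‖ ≤ 2 * r * Real.exp (r * |(0 : ℂ).re - 1 / 2|) := h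
      _ ≤ 2 * r * 1.25 := mul_le_mul_of_nonneg_left he (by positivity)
      _ = 2.5 * r := by ring
  have hM1 : ‖weilMellin f₀ 1‖ ≤ 2.5 * r := by
    have h := norm_weilMellin_flatLobe_zero_le (k := k) hr 1
    have ha : r * |(1 : ℂ).re - 1 / 2| ≤ 1 / 8 := by
      simp only [Complex.one_re]; rw [abs_of_pos (by norm_num)]; linarith
    have he : Real.exp (r * |(1 : ℂ).re - 1 / 2|) ≤ 1.25 := (Real.exp_le_exp.2 ha).trans he18
    calc ‖weilMellin f₀ 1‖ ≤ 2 * r * Real.exp (r * |(1 : ℂ).re - 1 / 2|) := h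
      _ ≤ 2 * r * 1.25 := mul_le_mul_of_nonneg_left he (by positivity)
      _ = 2.5 * r := by ring
  have hpolar : 2 * (weilMellin f₀ 0 * conj (weilMellin f₀ 1)).re ≤ 2 * (2.5 * r) ^ 2 := by
    have h1 : (weilMellin f₀ 0 * conj (weilMellin f₀ 1)).re ≤ ‖weilMellin f₀ 0 * conj (weilMellin f₀ 1)‖ :=
      Complex.re_le_norm _
    rw [norm_mul, Complex.norm_conj] at h1
    have h2 : ‖weilMellin f₀ 0‖ * ‖weilMellin f₀ 1‖ ≤ (2.5 * r) * (2.5 * r) :=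
      mul_le_mul hM0 hM1 (norm_nonneg _) (by positivity)
    nlinarith
  set G : ℝ → ℝ := fun t ↦ ‖weilMellin f₀ (1 / 2 + t * I)‖ ^ 2 with hG
  set F : ℝ → ℝ := fun u ↦ ‖weilMellin (flatProfile k) (1 / 2 + u * I)‖ ^ 2 * Real.log (1 + |u|) with hF
  have hGF : (fun t : ℝ ↦ G t * Real.log (1 + |r * t|)) = fun t : ℝ ↦ r ^ 2 * F (r * t) := by
    funext t
    simp only [hG, hF, hf₀]
    rw [norm_sq_weilMellin_flatLobe_half hr 0 t]
    ring
  have hintF : Integrable F := integrable_norm_sq_weilMellin_mul_log (isWeilTest_flatProfile k)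
  have hint2 : Integrable fun t : ℝ ↦ G t * Real.log (1 + |r * t|) := by
    rw [hGF]
    exact (hintF.comp_mul_left' hr.ne').const_mul _
  have hPl : ∫ t : ℝ, G t = 2 * π * N := by
    rw [hG, integral_norm_sq_weilMellin_half_line hf₀t]
    unfold weilNorm2Sq
    rw [hN0]
  have hint_rho := integrable_norm_sq_weilMellin_mul_reDigammaQuarter hf₀t
  have hint_log := integrable_norm_sq_weilMellin_mul_log hf₀t
  have hint_G : Integrable G := integrable_norm_sq_weilMellin_half_line hf₀t
  -- step 1: ρ ≤ log(1+|t|) + 3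
  have hstep1 : ∫ t : ℝ, G t * Literature.Analysis.SpecialFunctions.reDigammaQuarter t ≤
      ∫ t : ℝ, (G t * Real.log (1 + |t|) + 3 * G t) := by
    refine integral_mono hint_rho (hint_log.add (hint_G.const_mul 3)) fun t ↦ ?_
    have := reDigammaQuarter_le_log_add_three t
    have hG0 : 0 ≤ G t := sq_nonneg _
    nlinarith
  -- step 2: log(1+|t|) ≤ log(1/r) + log(1 + |r t|)
  have hstep2 : ∫ t : ℝ, (G t * Real.log (1 + |t|) + 3 * G t) ≤
      ∫ t : ℝ, (G t * Real.log (1 + |r * t|) + (Real.log (1 / r) + 3) * G t) := by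
    refine integral_mono (hint_log.add (hint_G.const_mul 3)) (hint2.add (hint_G.const_mul _)) fun t ↦ ?_
    have hG0 : 0 ≤ G t := sq_nonneg _
    have hlog : Real.log (1 + |t|) ≤ Real.log (1 / r) + Real.log (1 + |r * t|) := by
      rw [← Real.log_mul (by positivity) (by positivity)]
      refine Real.log_le_log (by positivity) ?_
      rw [abs_mul, abs_of_pos hr]
      have : 1 / r * (1 + r * |t|) = 1 / r + |t| := by field_simp
      rw [this]
      have : (1 : ℝ) ≤ 1 / r := by rw [le_div_iff₀ hr]; linarith
      linarith
    nlinarith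
  -- step 3: the substitution u = r t
  have hstep3 : ∫ t : ℝ, G t * Real.log (1 + |r * t|) = r * flatLogMoment k := by
    rw [hGF, integral_const_mul, Measure.integral_comp_mul_left F r, abs_of_pos (inv_pos.2 hr), smul_eq_mul]
    have hLF : flatLogMoment k = ∫ u : ℝ, F u := rfl
    rw [hLF]
    field_simp
  have harch : 1 / (2 * π) * ∫ t : ℝ, G t * Literature.Analysis.SpecialFunctions.reDigammaQuarter t ≤
      (Real.log (1 / r) + 3) * N + r * flatLogMoment k / (2 * π) := by
    have h12 := hstep1.trans hstep2
    rw [integral_add hint2 (hint_G.const_mul _), hstep3, integral_const_mul, hPl] at h12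
    have hπ : 0 < 2 * π := by positivity
    calc 1 / (2 * π) * ∫ t : ℝ, G t * Literature.Analysis.SpecialFunctions.reDigammaQuarter t
        ≤ 1 / (2 * π) * (r * flatLogMoment k + (Real.log (1 / r) + 3) * (2 * π * N)) :=
          mul_le_mul_of_nonneg_left h12 (by positivity)
      _ = (Real.log (1 / r) + 3) * N + r * flatLogMoment k / (2 * π) := by field_simp; ring
  -- assemble
  have hlogπ : 0 ≤ Real.log π := Real.log_nonneg (by linarith [Real.pi_gt_three])
  have hL := flatLogMoment_nonneg k
  have hA : 2 * (2.5 * r) ^ 2 ≤ 3.125 * N := by nlinarith [hNr, hr4, hr]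
  have hB : r * flatLogMoment k / (2 * π) ≤ flatLogMoment k / (2 * π) * N := by
    have hπ : 0 < π := Real.pi_pos
    rw [div_le_iff₀ (by positivity)]
    have : flatLogMoment k / (2 * π) * N * (2 * π) = flatLogMoment k * N := by field_simp
    rw [this]
    nlinarith [hNr, hL]
  have hGdef : (∫ t : ℝ, ‖weilMellin f₀ (1 / 2 + t * I)‖ ^ 2 *
      (Complex.digamma (1 / 4 + t / 2 * I)).re) = ∫ t : ℝ, G t * Literature.Analysis.SpecialFunctions.reDigammaQuarter t := rfl
  rw [hGdef, hN0]
  unfold flatEnergyConst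
  nlinarith [hpolar, harch, hA, hB, hlogπ, hNpos]

end Summit.RiemannHypothesis.RiemannHypothesis.Theorems.Handoff
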